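import Mathlib

/-!
# Route BarrierLever — item `PartitionMinorsHitByVP` (stmt-ValiantsHypothesis-19717), line `hidden_states`:
# INVARIANCES OF THE FULL JOIN — re-enumerating rows/columns and relabelling coordinates

Helper file (`--supports stmt-ValiantsHypothesis-19717`; cell valiant-natproofs, rung V4, 𝒟-side door (c), line
`Cruxes/PartitionMinorsHitByVP/Lines/hidden_states.lean` v8; prover seat val-np-p3 gen 16). Definition-free, `import Mathlib` only. Closes NO item.

THE POINT (memo val-np-p3 g16 «full join» §9). Bookkeeping lemmas that make the FJ toolkit (p672458 door, p673836/p674147 base,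
p674990/p675243/p675575/p676301 step, p675793 leaf) usable at the level of FAMILIES rather than enumerations:
* `fullJoin_reindex`: nonsingularity of the one-cube full hidden sum of `(u, w)` is invariant under re-enumerating the rows (`u ∘ ρ`) and the
  columns (`w ∘ ρ'`) by permutations of `Fin r` (the determinant changes by a sign);
* `fullJoin_relabel`: … and under relabelling the `x`-coordinates of `u` by a permutation `σ` of `Fin h` and the `y`-coordinates of `w` by
  `σ'` (the tables are relabelled accordingly) — so FJ depends only on the pair of ISOMORPHISM CLASSES of the two families, separately.

WHAT THIS IS NOT: no pair is certified here; item 19717 stays OPEN; nothing on crux 14610 or VP ≠ VNP.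
-/

set_option linter.dupNamespace false

namespace Summit.ValiantsHypothesis.ValiantsHypothesis.Theorems.BarrierLever.HiddenStates

open Finset Matrix

noncomputable section

namespace FullJoin

variable {h K r : ℕ}

/-- **Re-enumeration invariance.** If the one-cube full hidden sum of `(u, w)` is nonsingular at some table, so is that of
`(u ∘ ρ, w ∘ ρ')` for any permutations `ρ, ρ'` of the index set (same table; the determinant changes by `sign ρ · sign ρ'`). -/
theorem fullJoin_reindex (u w : Fin r → Finset (Fin h)) (ρ ρ' : Equiv.Perm (Fin r))
    (H : ∃ (tx ty : Option (Fin K) → Fin h → ℂ) (lam : Fin K → ℂ),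
      (Matrix.of fun i j : Fin r => ∑ J : Finset (Fin K), (∏ q ∈ J, lam q) *
        ((∏ a ∈ u i, (tx none a + ∑ q ∈ J, tx (some q) a)) * ∏ c ∈ w j, (ty none c + ∑ q ∈ J, ty (some q) c))).det ≠ 0) :
    ∃ (tx ty : Option (Fin K) → Fin h → ℂ) (lam : Fin K → ℂ),
      (Matrix.of fun i j : Fin r => ∑ J : Finset (Fin K), (∏ q ∈ J, lam q) *
        ((∏ a ∈ u (ρ i), (tx none a + ∑ q ∈ J, tx (some q) a)) *
          ∏ c ∈ w (ρ' j), (ty none c + ∑ q ∈ J, ty (some q) c))).det ≠ 0 := by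
  obtain ⟨tx, ty, lam, hdet⟩ := H
  refine ⟨tx, ty, lam, ?_⟩
  set M : Matrix (Fin r) (Fin r) ℂ := Matrix.of fun i j : Fin r => ∑ J : Finset (Fin K), (∏ q ∈ J, lam q) *
        ((∏ a ∈ u i, (tx none a + ∑ q ∈ J, tx (some q) a)) * ∏ c ∈ w j, (ty none c + ∑ q ∈ J, ty (some q) c)) with hM
  have hmat : (Matrix.of fun i j : Fin r => ∑ J : Finset (Fin K), (∏ q ∈ J, lam q) *
        ((∏ a ∈ u (ρ i), (tx none a + ∑ q ∈ J, tx (some q) a)) *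
          ∏ c ∈ w (ρ' j), (ty none c + ∑ q ∈ J, ty (some q) c))) = (M.submatrix ρ id).submatrix id ρ' := by
    refine Matrix.ext fun i j => ?_
    simp [hM, Matrix.submatrix_apply]
  rw [hmat, Matrix.det_permute', Matrix.det_permute]
  exact mul_ne_zero (by simp [Units.ne_zero]) (mul_ne_zero (by simp [Units.ne_zero]) hdet)

/-- Relabelling a set by a permutation relabels the block-additive factor: with the table `t' o c = t o (σ.symm c)`,
`∏_{c ∈ σ(W)} (t' none c + Σ_{q∈J} t' (some q) c) = ∏_{c ∈ W} (t none c + Σ_{q∈J} t (some q) c)`. -/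
theorem prod_map_perm (σ : Equiv.Perm (Fin h)) (t : Option (Fin K) → Fin h → ℂ) (W : Finset (Fin h)) (J : Finset (Fin K)) :
    (∏ c ∈ W.map σ.toEmbedding, ((fun o c => t o (σ.symm c)) none c + ∑ q ∈ J, (fun o c => t o (σ.symm c)) (some q) c)) =
      ∏ c ∈ W, (t none c + ∑ q ∈ J, t (some q) c) := by
  rw [Finset.prod_map]
  refine Finset.prod_congr rfl fun c _ => ?_
  simp only [Equiv.toEmbedding_apply, Equiv.symm_apply_apply]

/-- **Relabelling invariance.** If the one-cube full hidden sum of `(u, w)` is nonsingular at some table, so is that of the pair obtained by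
relabelling the coordinates of every `u i` by a permutation `σ` of `Fin h` and of every `w j` by `σ'` (independently). -/
theorem fullJoin_relabel (u w : Fin r → Finset (Fin h)) (σ σ' : Equiv.Perm (Fin h))
    (u' w' : Fin r → Finset (Fin h)) (hu' : ∀ i, u' i = (u i).map σ.toEmbedding) (hw' : ∀ j, w' j = (w j).map σ'.toEmbedding)
    (H : ∃ (tx ty : Option (Fin K) → Fin h → ℂ) (lam : Fin K → ℂ),
      (Matrix.of fun i j : Fin r => ∑ J : Finset (Fin K), (∏ q ∈ J, lam q) *
        ((∏ a ∈ u i, (tx none a + ∑ q ∈ J, tx (some q) a)) * ∏ c ∈ w j, (ty none c + ∑ q ∈ J, ty (some q) c))).det ≠ 0) :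
    ∃ (tx ty : Option (Fin K) → Fin h → ℂ) (lam : Fin K → ℂ),
      (Matrix.of fun i j : Fin r => ∑ J : Finset (Fin K), (∏ q ∈ J, lam q) *
        ((∏ a ∈ u' i, (tx none a + ∑ q ∈ J, tx (some q) a)) * ∏ c ∈ w' j, (ty none c + ∑ q ∈ J, ty (some q) c))).det ≠ 0 := by
  obtain ⟨tx, ty, lam, hdet⟩ := H
  refine ⟨fun o a => tx o (σ.symm a), fun o c => ty o (σ'.symm c), lam, ?_⟩
  have hmat : (Matrix.of fun i j : Fin r => ∑ J : Finset (Fin K), (∏ q ∈ J, lam q) *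
        ((∏ a ∈ u' i, ((fun o a => tx o (σ.symm a)) none a + ∑ q ∈ J, (fun o a => tx o (σ.symm a)) (some q) a)) *
          ∏ c ∈ w' j, ((fun o c => ty o (σ'.symm c)) none c + ∑ q ∈ J, (fun o c => ty o (σ'.symm c)) (some q) c))) =
      Matrix.of fun i j : Fin r => ∑ J : Finset (Fin K), (∏ q ∈ J, lam q) *
        ((∏ a ∈ u i, (tx none a + ∑ q ∈ J, tx (some q) a)) * ∏ c ∈ w j, (ty none c + ∑ q ∈ J, ty (some q) c)) := by
    refine Matrix.ext fun i j => ?_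
    simp only [Matrix.of_apply]
    refine Finset.sum_congr rfl fun J _ => ?_
    rw [hu' i, hw' j, prod_map_perm σ tx (u i) J, prod_map_perm σ' ty (w j) J]
  rw [hmat]
  exact hdet

end FullJoin

end

end Summit.ValiantsHypothesis.ValiantsHypothesis.Theorems.BarrierLever.HiddenStates
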